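import Literature.NumberTheory.EllipticCurves.ModularCurveKleinJ
import Mathlib.NumberTheory.ModularForms.Derivative
import Mathlib.NumberTheory.ModularForms.QExpansion
import HarnessLib

/-!
# Ramanujan's identities `D E₄ = (E₂E₄ − E₆)/3`, `D E₆ = (E₂E₆ − E₄²)/2`, `D Δ = E₂Δ`;
  `j' = −2πi E₄²E₆/Δ`; simple zeros of `E₄` at `ρ` and `E₆` at `i`; ramification of `j`
  (trunk EllArithM; layer 2 of the Riemann–Roch bridge to `dim S₂(Γ₀(N)) = g(X₀(N))`)

Continuing `ModularCurveKleinJ` (Klein's `j = E₄³/Δ`, the orbit criterion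
`j(τ₁) = j(τ₂) ↔ τ₂ ∈ SL₂(ℤ)τ₁`, zeros of `E₄`, `E₆`), this file supplies the local analysis of
`j : X(1) → ℙ¹` needed for the places of the modular function fields: the orders of vanishing of
`E₄³ − j(τ₀)Δ = Δ · (j − j(τ₀))` at `τ₀` are the ramification indices `3, 2, 1` (orbit of `ρ`,
orbit of `i`, otherwise). The route is Ramanujan's derivative identities, obtained from Mathlib's
Serre derivative (`Mathlib.NumberTheory.ModularForms.Derivative`: `normalizedDerivOfComplex`
`D = (2πi)⁻¹ d/dτ`, `serreDerivative`, `serreDerivative_slash_invariant`; Mathlib marks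
"Serre derivative preserves modularity" and the Ramanujan identities as TODO there) and the
level-one dimension formula.

## Main statements (all proved)

* `isZeroAtImInfty_normalizedDeriv`: for `f` holomorphic, `h`-periodic and bounded at `i∞`,
  `D f → 0` at `i∞`; `tendsto_E2_atImInfty`: `E₂ → 1`.
* `serreDerivForm f : ModularForm SL(2,ℤ) (k + 2)`: **the Serre derivative `ϑ_k f = D f − (k/12)E₂f`
  of a level-one modular form is a modular form** (Zagier, *1-2-3 of modular forms*, §5.1 Prop. 15).
* **Ramanujan's identities** `serreDerivForm_E₄ : ϑE₄ = −E₆/3`, `serreDerivForm_E₆ : ϑE₆ = −E₄²/2`,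
  `serreDerivForm_discriminant : ϑΔ = 0`, and pointwise `normalizedDeriv_E₄`, `normalizedDeriv_E₆`,
  `normalizedDeriv_discriminant` (Zagier §5.1 (53); Serre VII §4).
* `normalizedDeriv_kleinJ : D j = −E₄²E₆/Δ`, `deriv_kleinJ_comp_ofComplex : j' = −2πi E₄²E₆/Δ`,
  `deriv_kleinJ_ne_zero_iff : j'(τ) ≠ 0 ↔ E₄(τ)E₆(τ) ≠ 0`.
* `analyticOrderAt_E₄_rho`, `analyticOrderAt_E₆_I`: **`E₄` has a simple zero at `ρ`, `E₆` at
  `i`**; `analyticOrderAt_SL_slash`, `analyticOrderAt_levelOne_smul`: orders of vanishing are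
  transported by the slash action; `analyticOrderAt_E₄`, `analyticOrderAt_E₆`,
  `analyticOrderAt_discriminant`: orders at every point.
* `analyticOrderAt_E₄_cube_sub_kleinJ_mul_discriminant`: **`ord_{τ₀}(E₄³ − j(τ₀)Δ) = 3, 2, 1`**
  according as `E₄(τ₀) = 0`, `E₆(τ₀) = 0`, or neither (the ramification of `j`; Serre VII §3.3,
  Diamond–Shurman §2.3–2.4) — obtained from derivatives and the orbit criterion, not from the
  valence formula.

Everything is in `namespace Literature.ModularForms`.

## References

* D. Zagier, *Elliptic modular forms and their applications*, in: The 1-2-3 of Modular Forms,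
  Universitext, Springer 2008, §2.3 (19), §5.1 Prop. 15 and (53).
* J.-P. Serre, *A Course in Arithmetic*, GTM 7, Springer 1973, VII §3.2–3.3, §4.1.
* F. Diamond, J. Shurman, *A first course in modular forms*, GTM 228, Springer 2005, §1.1, §2.3–2.4.
-/

noncomputable section

open UpperHalfPlane hiding I
open ModularForm EisensteinSeries SlashInvariantForm ModularFormClass Complex Filter Function
open scoped MatrixGroups Real Topology Manifold

namespace Literature.NumberTheory.EllipticCurves.ModularForms

open Derivative

/-! ### `D f → 0` at the cusp for bounded holomorphic periodic `f` -/

/-- Derivative of the local parameter `q_h(z) = e^{2πiz/h}`: `q_h' = (2πi/h) q_h`. [folklore] -/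
theorem hasDerivAt_qParam (h : ℝ) (z : ℂ) :
    HasDerivAt (Periodic.qParam h) (2 * π * I / h * Periodic.qParam h z) z := by
  have h1 : HasDerivAt (fun w : ℂ ↦ 2 * π * I * w / h) (2 * π * I / h) z := by
    simpa using ((hasDerivAt_id z).const_mul (2 * π * I)).div_const (h : ℂ)
  have h2 := (Complex.hasDerivAt_exp (2 * π * I * z / h)).comp z h1
  have heq : (cexp ∘ fun w : ℂ ↦ 2 * π * I * w / h) = Periodic.qParam h := by
    ext w; simp [Periodic.qParam]
  rw [heq] at h2
  simpa [Periodic.qParam, mul_comm] using h2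

/-- Near a point of `ℍ`, an `h`-periodic `f ∘ ofComplex` agrees with `F ∘ q_h`, `F` its cusp
function. [folklore] -/
theorem comp_ofComplex_eventuallyEq_cuspFunction {f : ℍ → ℂ} {h : ℝ} (hh : 0 < h)
    (hper : Periodic (f ∘ ofComplex) h) (τ : ℍ) :
    (f ∘ ofComplex) =ᶠ[𝓝 (τ : ℂ)] fun w ↦ cuspFunction h f (Periodic.qParam h w) := by
  filter_upwards [isOpen_upperHalfPlaneSet.mem_nhds τ.im_pos] with w hw
  have := eq_cuspFunction (f := f) ⟨w, hw⟩ hh.ne' hper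
  simpa [ofComplex_apply_of_im_pos hw] using this.symm

/-- **The derivative of a bounded holomorphic periodic function vanishes at `i∞`**: for `f` on
`ℍ` holomorphic, `h`-periodic and bounded at `i∞`, `D f = (2πi)⁻¹ f' → 0` as `Im τ → ∞`
(`f = F(q_h)` with `F` analytic at `0`, so `f' = (2πi/h) q_h F'(q_h) → 0`). In particular
`D` of a modular form is zero at the cusp. [folklore] -/
theorem isZeroAtImInfty_normalizedDeriv {f : ℍ → ℂ} {h : ℝ} (hh : 0 < h)
    (hper : Periodic (f ∘ ofComplex) h) (hhol : MDiff f) (hbdd : IsBoundedAtImInfty f) :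
    IsZeroAtImInfty (D f) := by
  set F := cuspFunction h f with hF
  have hFan : AnalyticAt ℂ F 0 := analyticAt_cuspFunction_zero hh hper hhol hbdd
  -- formula for `D f`
  have hD : ∀ τ : ℍ, D f τ = deriv F (Periodic.qParam h τ) * Periodic.qParam h τ / h := by
    intro τ
    have h1 : HasDerivAt (fun w ↦ F (Periodic.qParam h w))
        (deriv F (Periodic.qParam h τ) * (2 * π * I / h * Periodic.qParam h τ)) τ := by
      refine HasDerivAt.comp (τ : ℂ) ?_ (hasDerivAt_qParam h τ)
      have hq : ‖Periodic.qParam h τ‖ < 1 := Periodic.norm_qParam_lt_one hh τ.im_pos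
      exact (differentiableAt_cuspFunction hh hper hhol hbdd hq).hasDerivAt
    have h2 : deriv (f ∘ ofComplex) τ =
        deriv F (Periodic.qParam h τ) * (2 * π * I / h * Periodic.qParam h τ) := by
      rw [(comp_ofComplex_eventuallyEq_cuspFunction hh hper τ).deriv_eq]
      exact h1.deriv
    rw [normalizedDerivOfComplex, h2]
    have : (2 * π * I : ℂ) ≠ 0 := by simp [Real.pi_ne_zero]
    field_simp
  -- limit
  have hq0 : Tendsto (fun τ : ℍ ↦ Periodic.qParam h τ) atImInfty (𝓝 0) := qParam_tendsto_atImInfty hh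
  have hdF : Tendsto (fun τ : ℍ ↦ deriv F (Periodic.qParam h τ)) atImInfty (𝓝 (deriv F 0)) :=
    hFan.deriv.continuousAt.tendsto.comp hq0
  have : Tendsto (fun τ : ℍ ↦ deriv F (Periodic.qParam h τ) * Periodic.qParam h τ / h) atImInfty
      (𝓝 (deriv F 0 * 0 / h)) := (hdF.mul hq0).div_const _
  rw [mul_zero, zero_div] at this
  exact this.congr fun τ ↦ (hD τ).symm

/-- For a modular form `f` of level one, `D f → 0` at `i∞`. [folklore] -/
theorem isZeroAtImInfty_normalizedDeriv_levelOne {k : ℤ} (f : ModularForm 𝒮ℒ k) :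
    IsZeroAtImInfty (D f) :=
  isZeroAtImInfty_normalizedDeriv one_pos
    (by simpa using SlashInvariantFormClass.periodic_comp_ofComplex (h := 1) f one_mem_strictPeriods_SL) f.holo'
    (ModularFormClass.bdd_at_infty f)

/-! ### `E₂` at the cusp -/

/-- `E₂(τ + 1) = E₂(τ)`: `E₂ ∘ ofComplex` is `1`-periodic (from `E₂|T = E₂`). [folklore] -/
theorem periodic_E2_comp_ofComplex : Periodic (E2 ∘ ofComplex) 1 := by
  intro w
  by_cases hw : 0 < w.im
  · have hw' : 0 < (w + 1).im := by simpa using hw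
    simp only [Function.comp_apply, ofComplex_apply_of_im_pos hw, ofComplex_apply_of_im_pos hw']
    have hT := congrFun (E2_slash_action ModularGroup.T) ⟨w, hw⟩
    rw [D2_T, smul_zero, sub_zero, SL_slash_apply, ModularGroup.denom_apply] at hT
    have hTw : ModularGroup.T • (⟨w, hw⟩ : ℍ) = ⟨w + 1, hw'⟩ := by
      apply UpperHalfPlane.ext
      change ((ModularGroup.T • (⟨w, hw⟩ : ℍ) : ℍ) : ℂ) = w + 1
      rw [UpperHalfPlane.modular_T_smul, UpperHalfPlane.coe_vadd]
      simp [add_comm]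
    rw [hTw] at hT
    rw [← hT]
    simp [ModularGroup.T]
  · have hw' : ¬ 0 < (w + 1).im := by simpa using hw
    simp only [Function.comp_apply, ofComplex_apply_of_im_nonpos (not_lt.mp hw),
      ofComplex_apply_of_im_nonpos (not_lt.mp hw')]

/-- **`E₂ → 1` at `i∞`** (constant term of `E₂ = 1 − 24∑σ₁(n)qⁿ`). [folklore] -/
theorem tendsto_E2_atImInfty : Tendsto E2 atImInfty (𝓝 1) := by
  have han : AnalyticAt ℂ (cuspFunction 1 E2) 0 :=
    analyticAt_cuspFunction_zero one_pos periodic_E2_comp_ofComplex E2_mdifferentiable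
      isBoundedAtImInfty_E2
  set c : ℕ → ℂ := fun m ↦ if m = 0 then 1 else -24 * (((ArithmeticFunction.sigma 1 : ArithmeticFunction ℕ) m : ℕ) : ℂ) with hc
  have hsum : ∀ τ : ℍ, HasSum (fun m ↦ c m • Periodic.qParam 1 τ ^ m) (E2 τ) := fun τ ↦ by
    simpa only [hc, Periodic.qParam, ofReal_one, div_one] using hasSum_qExpansion_E2 (z := τ)
  have hps := hasFPowerSeriesOnBall_cuspFunction one_pos han hsum
  have h0 : cuspFunction 1 E2 0 = 1 := by
    have := hps.coeff_zero (fun _ ↦ (0 : ℂ))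
    rw [FormalMultilinearSeries.ofScalars_apply_eq] at this
    simpa [hc] using this.symm
  have : (cuspFunction 1 E2 ∘ fun τ : ℍ ↦ Periodic.qParam 1 τ) = E2 := by
    funext τ
    simpa using eq_cuspFunction τ one_ne_zero periodic_E2_comp_ofComplex
  rw [← this, ← h0]
  exact han.continuousAt.tendsto.comp (qParam_tendsto_atImInfty one_pos)

/-! ### The Serre derivative of a level-one modular form -/

/-- For `γ ∈ SL₂(ℤ)` a level-one modular form satisfies `f|γ = f` (slash action by `SL₂(ℤ)`).
[folklore] -/
theorem levelOne_slash_eq {k : ℤ} (f : ModularForm 𝒮ℒ k) (γ : SL(2, ℤ)) :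
    (f : ℍ → ℂ) ∣[k] γ = f := by
  have := f.slash_action_eq' (γ : GL (Fin 2) ℝ) ⟨γ, rfl⟩
  simpa [ModularForm.SL_slash] using this

/-- The Serre derivative `ϑ_k f = D f − (k/12) E₂ f` is bounded at `i∞` for a level-one modular
form (`D f → 0`, `E₂, f` bounded). [folklore] -/
theorem isBoundedAtImInfty_serreDerivative {k : ℤ} (f : ModularForm 𝒮ℒ k) :
    IsBoundedAtImInfty (serreDerivative k f) := by
  have h1 : IsBoundedAtImInfty (D f) := (isZeroAtImInfty_normalizedDeriv_levelOne f).boundedAtFilter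
  have h2 : IsBoundedAtImInfty (fun τ ↦ (k : ℂ) * 12⁻¹ * E2 τ * f τ) := by
    have := (isBoundedAtImInfty_E2.mul (ModularFormClass.bdd_at_infty f)).const_mul_left
      ((k : ℂ) * 12⁻¹)
    refine this.congr_left fun τ ↦ ?_
    simp only [Pi.mul_apply]; ring
  have hs : serreDerivative k f = fun z ↦ D f z - k * 12⁻¹ * E2 z * f z := rfl
  rw [hs]
  exact h1.sub h2

/-- **The Serre derivative preserves level-one modular forms**: `ϑ_k f = D f − (k/12)E₂ f` is a
modular form of weight `k + 2` for `f ∈ M_k(SL₂(ℤ))` (Serre derivative equivariance is Mathlib's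
`serreDerivative_slash_invariant`; boundedness at the cusp from `D f → 0`) (Zagier, *Elliptic
modular forms and their applications* (1-2-3 of modular forms), §5.1 Prop. 15; Lang, *Introduction
to Modular Forms*, X §5). [folklore] -/
def serreDerivForm {k : ℤ} (f : ModularForm 𝒮ℒ k) : ModularForm 𝒮ℒ (k + 2) where
  toFun := serreDerivative k f
  slash_action_eq' A hA := by
    obtain ⟨γ, rfl⟩ := hA
    exact serreDerivative_slash_invariant (k := k) (holo f) (γ := γ) (levelOne_slash_eq f γ)
  holo' := serreDerivative_mdifferentiable k (holo f)
  bdd_at_cusps' {c} hc := by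
    rw [OnePoint.isBoundedAt_iff_forall_SL2Z hc]
    intro γ _
    have := serreDerivative_slash_invariant (k := k) (holo f) (γ := γ) (levelOne_slash_eq f γ)
    rw [this]
    exact isBoundedAtImInfty_serreDerivative f

/-- Pointwise formula for `serreDerivForm`. [folklore] -/
@[simp]
theorem serreDerivForm_apply {k : ℤ} (f : ModularForm 𝒮ℒ k) (τ : ℍ) :
    serreDerivForm f τ = D f τ - k * 12⁻¹ * E2 τ * f τ := rfl

/-- `ϑ_k f → −(k/12) · a₀(f)` at `i∞` if `f → a₀(f)`. [folklore] -/
theorem tendsto_serreDerivForm {k : ℤ} (f : ModularForm 𝒮ℒ k) {a : ℂ}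
    (hf : Tendsto (fun τ ↦ f τ) atImInfty (𝓝 a)) :
    Tendsto (fun τ ↦ serreDerivForm f τ) atImInfty (𝓝 (-(k * 12⁻¹ * a))) := by
  have h1 : Tendsto (fun τ ↦ D f τ) atImInfty (𝓝 0) := isZeroAtImInfty_normalizedDeriv_levelOne f
  have := h1.sub (((tendsto_E2_atImInfty).const_mul ((k : ℂ) * 12⁻¹)).mul hf)
  simp only [mul_one, zero_sub] at this
  simpa [serreDerivForm_apply, mul_assoc] using this

/-! ### Ramanujan's identities -/

/-- In a one-dimensional space of modular forms spanned by `g`, a form is determined by its value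
at the cusp: if `f → a`, `g → b ≠ 0` at `i∞` then `f = (a/b) g`. [folklore] -/
theorem eq_smul_of_rank_eq_one {k : ℤ} (hV : Module.rank ℂ (ModularForm 𝒮ℒ k) = 1)
    {f g : ModularForm 𝒮ℒ k} (hg : g ≠ 0) {a b : ℂ} (hb : b ≠ 0)
    (hfa : Tendsto (fun τ ↦ f τ) atImInfty (𝓝 a)) (hgb : Tendsto (fun τ ↦ g τ) atImInfty (𝓝 b)) :
    (f : ℍ → ℂ) = (a / b) • (g : ℍ → ℂ) := by
  obtain ⟨c, hc⟩ := (finrank_eq_one_iff_of_nonzero' g hg).mp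
    (Module.rank_eq_one_iff_finrank_eq_one.mp hV) f
  have hc' : (f : ℍ → ℂ) = c • (g : ℍ → ℂ) := by rw [← hc]; simp
  have hlim : Tendsto (fun τ ↦ f τ) atImInfty (𝓝 (c * b)) := by
    have := hgb.const_mul c
    exact this.congr fun τ ↦ by simp [hc']
  have hab : a = c * b := tendsto_nhds_unique hfa hlim
  rw [hc', hab, mul_div_cancel_right₀ _ hb]

/-- **Ramanujan**: `ϑ₄ E₄ = −E₆/3`, i.e. `D E₄ = (E₂E₄ − E₆)/3` (Zagier, 1-2-3 §5.1 (53);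
Serre VII §4.1). Proof: `ϑ₄E₄ ∈ M₆ = ℂE₆`, constant terms `−1/3` and `1`. [folklore] -/
theorem serreDerivForm_E₄ : (serreDerivForm E₄ : ℍ → ℂ) = (-3⁻¹ : ℂ) • (E₆ : ℍ → ℂ) := by
  have h6 : Module.rank ℂ (ModularForm 𝒮ℒ 6) = 1 := ModularForm.levelOne_weight_six_rank_one
  have hE6 : (E₆ : ModularForm 𝒮ℒ 6) ≠ 0 := by
    intro h
    have := ModularForm.tendsto_E_atImInfty (k := 6) (by norm_num) ⟨3, rfl⟩
    rw [show E (by norm_num : 3 ≤ 6) = E₆ from rfl, h] at this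
    exact one_ne_zero (tendsto_nhds_unique (tendsto_const_nhds) this).symm
  have hf := tendsto_serreDerivForm E₄ (ModularForm.tendsto_E_atImInfty (k := 4) (by norm_num) ⟨2, rfl⟩)
  have := eq_smul_of_rank_eq_one (k := 6) h6 (f := (serreDerivForm E₄).mcast (by norm_num)) hE6
    one_ne_zero hf (ModularForm.tendsto_E_atImInfty (k := 6) (by norm_num) ⟨3, rfl⟩)
  simp only [coe_mcast] at this
  rw [this]; norm_num

/-- **Ramanujan**: `D E₄ = (E₂ E₄ − E₆)/3` pointwise (Zagier 1-2-3, §5.1 Prop. 15 / (53)). [folklore] -/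
theorem normalizedDeriv_E₄ (τ : ℍ) : D E₄ τ = 3⁻¹ * (E2 τ * E₄ τ - E₆ τ) := by
  have := congrFun serreDerivForm_E₄ τ
  simp only [serreDerivForm_apply, Pi.smul_apply, smul_eq_mul] at this
  linear_combination this

/-- **Ramanujan**: `ϑ₆ E₆ = −E₄²/2`, i.e. `D E₆ = (E₂E₆ − E₄²)/2` (`ϑ₆E₆ ∈ M₈ = ℂE₄²`).
[folklore] -/
theorem serreDerivForm_E₆ :
    (serreDerivForm E₆ : ℍ → ℂ) = (-2⁻¹ : ℂ) • ((E₄ : ℍ → ℂ) * (E₄ : ℍ → ℂ)) := by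
  have h8 : Module.rank ℂ (ModularForm 𝒮ℒ 8) = 1 := by
    have := ModularForm.dimension_level_one 8 ⟨4, rfl⟩
    norm_num [Nat.ModEq] at this
    exact_mod_cast this
  have h4 := ModularForm.tendsto_E_atImInfty (k := 4) (by norm_num) ⟨2, rfl⟩
  set E4sq : ModularForm 𝒮ℒ 8 := (E₄.mul E₄).mcast (by norm_num) with hE4sq
  have hsq : Tendsto (fun τ ↦ E4sq τ) atImInfty (𝓝 1) := by
    have h := h4.mul h4
    rw [mul_one] at h
    exact h.congr fun τ ↦ rfl
  have hne : E4sq ≠ 0 := by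
    intro h
    rw [h] at hsq
    exact one_ne_zero (tendsto_nhds_unique (tendsto_const_nhds) hsq).symm
  have hf := tendsto_serreDerivForm E₆ (ModularForm.tendsto_E_atImInfty (k := 6) (by norm_num) ⟨3, rfl⟩)
  have := eq_smul_of_rank_eq_one (k := 8) h8 (f := (serreDerivForm E₆).mcast (by norm_num)) hne
    one_ne_zero hf hsq
  simp only [coe_mcast, hE4sq, ModularForm.coe_mul] at this
  rw [this]; norm_num

/-- **Ramanujan**: `D E₆ = (E₂ E₆ − E₄²)/2` pointwise. [folklore] -/
theorem normalizedDeriv_E₆ (τ : ℍ) : D E₆ τ = 2⁻¹ * (E2 τ * E₆ τ - E₄ τ ^ 2) := by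
  have := congrFun serreDerivForm_E₆ τ
  simp only [serreDerivForm_apply, Pi.smul_apply, Pi.mul_apply, smul_eq_mul] at this
  linear_combination this

/-- **Ramanujan**: `ϑ₁₂ Δ = 0`, i.e. `D Δ = E₂ Δ` (`ϑ₁₂Δ` is a cusp form of weight `14`, and
`S₁₄(SL₂(ℤ)) = 0`). [folklore] -/
theorem serreDerivForm_discriminant :
    (serreDerivForm (ModularFormClass.modularForm CuspForm.discriminant) : ℍ → ℂ) = 0 := by
  set f := serreDerivForm (ModularFormClass.modularForm CuspForm.discriminant) with hf
  -- `f` is a cusp form of weight 14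
  have hzero : IsZeroAtImInfty f := by
    have hΔ : Tendsto (fun τ ↦ (ModularFormClass.modularForm CuspForm.discriminant : ℍ → ℂ) τ)
        atImInfty (𝓝 0) := ModularForm.discriminant_isZeroAtImInfty
    have := tendsto_serreDerivForm (ModularFormClass.modularForm CuspForm.discriminant) hΔ
    rw [mul_zero, neg_zero] at this
    exact this
  have h0 : (qExpansion 1 f).coeff 0 = 0 := by
    rw [qExpansion_coeff_zero one_pos
      (ModularFormClass.analyticAt_cuspFunction_zero f one_pos one_mem_strictPeriods_SL)
      (by simpa using SlashInvariantFormClass.periodic_comp_ofComplex (h := 1) f one_mem_strictPeriods_SL),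
      hzero.valueAtInfty_eq_zero]
  set g : CuspForm 𝒮ℒ (12 + 2) := toCuspForm f h0 with hg
  have hS : Module.rank ℂ (CuspForm 𝒮ℒ (12 + 2)) = 0 := by
    rw [CuspForm.discriminantEquiv.rank_eq]
    exact_mod_cast ModularForm.levelOne_weight_two_rank_zero
  have hg0 : g = 0 := rank_zero_iff_forall_zero.mp hS g
  have : (f : ℍ → ℂ) = (g : ℍ → ℂ) := rfl
  rw [this, hg0]; rfl

/-- **Ramanujan**: `D Δ = E₂ Δ` pointwise. [folklore] -/
theorem normalizedDeriv_discriminant (τ : ℍ) :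
    D ModularForm.discriminant τ = E2 τ * ModularForm.discriminant τ := by
  have := congrFun serreDerivForm_discriminant τ
  simp only [serreDerivForm_apply, Pi.zero_apply] at this
  have h : (ModularFormClass.modularForm CuspForm.discriminant : ℍ → ℂ) = ModularForm.discriminant := rfl
  rw [h] at this
  linear_combination this

/-! ### The derivative of `j` -/

/-- **`D j = −E₄² E₆/Δ`**, i.e. `j' = −2πi E₄²E₆/Δ = −2πi E₁₄/Δ` (from Ramanujan's identities:
`D(jΔ) = D(E₄³) = 3E₄² D E₄ = E₂E₄³ − E₄²E₆` and `DΔ = E₂Δ`) (Zagier, 1-2-3 of modular forms,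
§5.1; classical). [folklore] -/
theorem normalizedDeriv_kleinJ (τ : ℍ) :
    D kleinJ τ = -(E₄ τ ^ 2 * E₆ τ / ModularForm.discriminant τ) := by
  have hΔ := ModularForm.discriminant_ne_zero τ
  have hjΔ : (kleinJ * ModularForm.discriminant : ℍ → ℂ) = (E₄ : ℍ → ℂ) ^ 3 := by
    funext z; simp [E₄_cube_eq_kleinJ_mul]
  have hD := congrFun (normalizedDerivOfComplex_mul kleinJ ModularForm.discriminant
    mdifferentiable_kleinJ (holo CuspForm.discriminant)) τ
  rw [hjΔ, normalizedDerivOfComplex_pow _ 3 (holo E₄)] at hD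
  simp only [Pi.add_apply, Pi.mul_apply, Pi.pow_apply, Nat.cast_ofNat, Pi.ofNat_apply] at hD
  rw [normalizedDeriv_E₄, normalizedDeriv_discriminant] at hD
  have hj := E₄_cube_eq_kleinJ_mul τ
  -- `hD : 3 E₄² (1/3)(E₂E₄ − E₆) = D j · Δ + j · (E₂ Δ)`, `hj : E₄³ = j Δ`
  norm_num at hD
  have key : D kleinJ τ * ModularForm.discriminant τ = -(E₄ τ ^ 2 * E₆ τ) := by
    linear_combination -hD + E2 τ * hj
  rw [eq_div_of_mul_eq hΔ key, neg_div]

/-- The complex derivative of `j`: `(j ∘ ofComplex)'(τ) = −2πi E₄(τ)²E₆(τ)/Δ(τ)`. [folklore] -/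
theorem deriv_kleinJ_comp_ofComplex (τ : ℍ) :
    deriv (kleinJ ∘ ofComplex) τ = -(2 * π * I) * (E₄ τ ^ 2 * E₆ τ / ModularForm.discriminant τ) := by
  have h := normalizedDeriv_kleinJ τ
  rw [normalizedDerivOfComplex] at h
  have h2 : (2 * π * I : ℂ) ≠ 0 := by simp [Real.pi_ne_zero]
  field_simp at h
  linear_combination h

/-- **`j'(τ) = 0` exactly on the orbits of `i` and `ρ`** (the elliptic points of `SL₂(ℤ)`):
`(j ∘ ofComplex)'(τ) ≠ 0 ↔ E₄(τ) ≠ 0 ∧ E₆(τ) ≠ 0`. [folklore] -/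
theorem deriv_kleinJ_ne_zero_iff (τ : ℍ) :
    deriv (kleinJ ∘ ofComplex) τ ≠ 0 ↔ E₄ τ ≠ 0 ∧ E₆ τ ≠ 0 := by
  rw [deriv_kleinJ_comp_ofComplex]
  have h2 : (2 * π * I : ℂ) ≠ 0 := by simp [Real.pi_ne_zero]
  have hΔ := ModularForm.discriminant_ne_zero τ
  simp only [ne_eq, neg_mul, neg_eq_zero, mul_eq_zero, h2, false_or, div_eq_zero_iff, hΔ,
    or_false, pow_eq_zero_iff, OfNat.ofNat_ne_zero, not_false_eq_true, not_or]

/-! ### Simple zeros of `E₄` at `ρ`, of `E₆` at `i`; orders along orbits -/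

/-- `E₄(ρ) = 0`. [folklore] -/
theorem E₄_rho : E₄ UpperHalfPlane.ρ = 0 := E₄_eq_zero_iff.mpr ⟨1, one_smul _ _⟩

/-- `E₆(i) = 0`. [folklore] -/
theorem E₆_I : E₆ UpperHalfPlane.I = 0 := E₆_eq_zero_iff.mpr ⟨1, one_smul _ _⟩

/-- `E₆(ρ) ≠ 0` (else `Δ(ρ) = (E₄³ − E₆²)/1728 = 0`). [folklore] -/
theorem E₆_rho_ne_zero : E₆ UpperHalfPlane.ρ ≠ 0 := by
  intro h
  have := ModularForm.discriminant_ne_zero UpperHalfPlane.ρ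
  rw [ModularForm.discriminant_eq_E₄_cube_sub_E₆_sq, E₄_rho, h] at this
  norm_num at this

/-- `E₄(i) ≠ 0` (else `Δ(i) = 0`). [folklore] -/
theorem E₄_I_ne_zero : E₄ UpperHalfPlane.I ≠ 0 := by
  intro h
  have := ModularForm.discriminant_ne_zero UpperHalfPlane.I
  rw [ModularForm.discriminant_eq_E₄_cube_sub_E₆_sq, E₆_I, h] at this
  norm_num at this

/-- For a holomorphic `f : ℍ → ℂ`, `f ∘ ofComplex` is analytic at points of `ℍ`. [folklore] -/
theorem analyticAt_comp_ofComplex {f : ℍ → ℂ} (hf : MDiff f) (τ : ℍ) :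
    AnalyticAt ℂ (f ∘ ofComplex) τ :=
  (UpperHalfPlane.mdifferentiable_iff.mp hf).analyticAt (isOpen_upperHalfPlaneSet.mem_nhds τ.im_pos)

/-- `deriv (f ∘ ofComplex) τ = 2πi · D f τ`. [folklore] -/
theorem deriv_comp_ofComplex_eq (f : ℍ → ℂ) (τ : ℍ) :
    deriv (f ∘ ofComplex) τ = 2 * π * I * D f τ := by
  rw [normalizedDerivOfComplex]
  have h2 : (2 * π * I : ℂ) ≠ 0 := by simp [Real.pi_ne_zero]
  field_simp

/-- **`E₄` has a simple zero at `ρ`**: `ord_ρ(E₄) = 1` (`E₄'(ρ) = (2πi/3)(E₂E₄ − E₆)(ρ)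
= −(2πi/3)E₆(ρ) ≠ 0`) (Serre VII §3.2, valence formula for weight `4`). [folklore] -/
theorem analyticOrderAt_E₄_rho :
    analyticOrderAt ((E₄ : ℍ → ℂ) ∘ ofComplex) UpperHalfPlane.ρ = 1 := by
  refine (analyticAt_comp_ofComplex (holo E₄) _).analyticOrderAt_eq_one_of_zero_deriv_ne_zero
    (by rw [Function.comp_apply, ofComplex_apply]; exact E₄_rho) ?_
  rw [deriv_comp_ofComplex_eq, normalizedDeriv_E₄, E₄_rho]
  have h2 : (2 * π * I : ℂ) ≠ 0 := by simp [Real.pi_ne_zero]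
  simpa [h2] using E₆_rho_ne_zero

/-- **`E₆` has a simple zero at `i`**: `ord_i(E₆) = 1` (`E₆'(i) = −πi E₄(i)² ≠ 0`)
(Serre VII §3.2). [folklore] -/
theorem analyticOrderAt_E₆_I :
    analyticOrderAt ((E₆ : ℍ → ℂ) ∘ ofComplex) UpperHalfPlane.I = 1 := by
  refine (analyticAt_comp_ofComplex (holo E₆) _).analyticOrderAt_eq_one_of_zero_deriv_ne_zero
    (by rw [Function.comp_apply, ofComplex_apply]; exact E₆_I) ?_
  rw [deriv_comp_ofComplex_eq, normalizedDeriv_E₆, E₆_I]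
  have h2 : (2 * π * I : ℂ) ≠ 0 := by simp [Real.pi_ne_zero]
  simpa [h2] using E₄_I_ne_zero

/-! ### Orders of vanishing and the `SL₂(ℤ)`-action -/

/-- The Möbius map `z ↦ γ·z` (extended by `ofComplex`) is analytic at points of `ℍ`. [folklore] -/
theorem analyticAt_smul_ofComplex {g : GL (Fin 2) ℝ} (hg : 0 < g.val.det) (τ : ℍ) :
    AnalyticAt ℂ (fun z : ℂ ↦ ((g • ofComplex z : ℍ) : ℂ)) τ := by
  apply DifferentiableOn.analyticAt (s := {z : ℂ | 0 < z.im})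
  · intro z hz
    exact ((hasStrictDerivAt_smul hg ⟨z, hz⟩).hasDerivAt.differentiableAt).differentiableWithinAt
  · exact isOpen_upperHalfPlaneSet.mem_nhds τ.im_pos

/-- **Orders of vanishing are transported by the slash action**: for holomorphic `f` on `ℍ`,
`ord_τ (f|_k γ) = ord_{γτ} f` (`(f|_kγ)(z) = f(γz)(cz+d)^{-k}`, `γ` is a local biholomorphism
and `(cz + d)^{-k}` a unit). [folklore] -/
theorem analyticOrderAt_SL_slash {k : ℤ} {f : ℍ → ℂ} (hf : MDiff f) (γ : SL(2, ℤ)) (τ : ℍ) :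
    analyticOrderAt ((f ∣[k] γ) ∘ ofComplex) τ = analyticOrderAt (f ∘ ofComplex) ↑(γ • τ) := by
  have hdet : 0 < ((γ : GL (Fin 2) ℝ)).val.det := by
    have : ((γ : GL (Fin 2) ℝ)).val.det = 1 := by
      rw [← Matrix.GeneralLinearGroup.val_det_apply]; simp
    rw [this]; exact one_pos
  set g : ℂ → ℂ := fun z ↦ ((((γ : GL (Fin 2) ℝ)) • ofComplex z : ℍ) : ℂ) with hg
  have hga : AnalyticAt ℂ g τ := analyticAt_smul_ofComplex hdet τ
  have hg' : deriv g τ ≠ 0 := deriv_smul_ne_zero hdet τ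
  have hgτ : g τ = ↑(γ • τ) := by simp [hg, ofComplex_apply]
  -- the unit factor
  set u : ℂ → ℂ := fun z ↦ denom (γ : GL (Fin 2) ℝ) z ^ (-k) with hu
  have hua : AnalyticAt ℂ u τ := by
    apply DifferentiableOn.analyticAt (s := {z : ℂ | z.im ≠ 0})
    · intro z hz
      refine DifferentiableAt.differentiableWithinAt ?_
      exact (((differentiableAt_id.const_mul _).add_const _).zpow (Or.inl (denom_ne_zero_of_im _ hz)))
    · exact (isOpen_ne_fun Complex.continuous_im continuous_const).mem_nhds τ.im_ne_zero
  have hu0 : u τ ≠ 0 := zpow_ne_zero _ (denom_ne_zero _ τ)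
  -- local formula
  have heq : ((f ∣[k] γ) ∘ ofComplex) =ᶠ[𝓝 (τ : ℂ)] fun z ↦ (f ∘ ofComplex) (g z) * u z := by
    filter_upwards [isOpen_upperHalfPlaneSet.mem_nhds τ.im_pos] with z hz
    simp only [Function.comp_apply, ofComplex_apply_of_im_pos hz, hg, hu, ModularForm.SL_slash_apply,
      ofComplex_apply, ModularGroup.sl_moeb]
  rw [analyticOrderAt_congr heq]
  have hfa : AnalyticAt ℂ (f ∘ ofComplex) (g τ) := hgτ ▸ analyticAt_comp_ofComplex hf _
  have h1 : AnalyticAt ℂ (fun z ↦ (f ∘ ofComplex) (g z)) τ := hfa.comp hga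
  rw [show (fun z ↦ (f ∘ ofComplex) (g z) * u z) = (fun z ↦ (f ∘ ofComplex) (g z)) * u from rfl,
    analyticOrderAt_mul h1 hua, hua.analyticOrderAt_eq_zero.mpr hu0, add_zero,
    show (fun z ↦ (f ∘ ofComplex) (g z)) = (f ∘ ofComplex) ∘ g from rfl,
    analyticOrderAt_comp_of_deriv_ne_zero hga hg', hgτ]

/-- For a level-one modular form the order of vanishing is constant on `SL₂(ℤ)`-orbits:
`ord_{γτ} f = ord_τ f`. [folklore] -/
theorem analyticOrderAt_levelOne_smul {k : ℤ} (f : ModularForm 𝒮ℒ k) (γ : SL(2, ℤ)) (τ : ℍ) :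
    analyticOrderAt ((f : ℍ → ℂ) ∘ ofComplex) ↑(γ • τ) = analyticOrderAt ((f : ℍ → ℂ) ∘ ofComplex) τ := by
  rw [← analyticOrderAt_SL_slash (holo f) γ τ, levelOne_slash_eq f γ]

/-- **`ord(E₄) = 1` along the orbit of `ρ`** and `E₄ ≠ 0` elsewhere. [folklore] -/
theorem analyticOrderAt_E₄ (τ : ℍ) :
    analyticOrderAt ((E₄ : ℍ → ℂ) ∘ ofComplex) τ = if E₄ τ = 0 then 1 else 0 := by
  split_ifs with h
  · obtain ⟨γ, rfl⟩ := E₄_eq_zero_iff.mp h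
    rw [analyticOrderAt_levelOne_smul, analyticOrderAt_E₄_rho]
  · exact (analyticAt_comp_ofComplex (holo E₄) τ).analyticOrderAt_eq_zero.mpr
      (by rwa [Function.comp_apply, ofComplex_apply])

/-- **`ord(E₆) = 1` along the orbit of `i`** and `E₆ ≠ 0` elsewhere. [folklore] -/
theorem analyticOrderAt_E₆ (τ : ℍ) :
    analyticOrderAt ((E₆ : ℍ → ℂ) ∘ ofComplex) τ = if E₆ τ = 0 then 1 else 0 := by
  split_ifs with h
  · obtain ⟨γ, rfl⟩ := E₆_eq_zero_iff.mp h
    rw [analyticOrderAt_levelOne_smul, analyticOrderAt_E₆_I]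
  · exact (analyticAt_comp_ofComplex (holo E₆) τ).analyticOrderAt_eq_zero.mpr
      (by rwa [Function.comp_apply, ofComplex_apply])

/-- `Δ` has no zeros: `ord_τ Δ = 0`. [folklore] -/
theorem analyticOrderAt_discriminant (τ : ℍ) :
    analyticOrderAt (ModularForm.discriminant ∘ ofComplex) τ = 0 :=
  (analyticAt_comp_ofComplex (holo CuspForm.discriminant) τ).analyticOrderAt_eq_zero.mpr
    (by rw [Function.comp_apply, ofComplex_apply]; exact ModularForm.discriminant_ne_zero τ)

/-- **The order of `j − j(τ₀)` at `τ₀`**, in the holomorphic form `E₄³ − j(τ₀)Δ = Δ(j − j(τ₀))`: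
it is `3` on the orbit of `ρ` (`E₄ = 0`), `2` on the orbit of `i` (`E₆ = 0`) and `1` elsewhere
— the ramification indices of `j : X(1) → ℙ¹`, i.e. half the orders of the stabilisers in
`SL₂(ℤ)` (Serre VII §3.3; Diamond–Shurman §2.3–2.4). [folklore] -/
theorem analyticOrderAt_E₄_cube_sub_kleinJ_mul_discriminant (τ₀ : ℍ) :
    analyticOrderAt ((fun τ : ℍ ↦ E₄ τ ^ 3 - kleinJ τ₀ * ModularForm.discriminant τ) ∘ ofComplex) τ₀ =
      if E₄ τ₀ = 0 then 3 else if E₆ τ₀ = 0 then 2 else 1 := by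
  have hΔa : AnalyticAt ℂ (ModularForm.discriminant ∘ ofComplex) τ₀ :=
    analyticAt_comp_ofComplex (holo CuspForm.discriminant) τ₀
  have h4a := analyticAt_comp_ofComplex (holo E₄) τ₀
  have h6a := analyticAt_comp_ofComplex (holo E₆) τ₀
  by_cases h4 : E₄ τ₀ = 0
  · -- orbit of ρ: `j(τ₀) = 0`, the form is `E₄³`
    have hj : kleinJ τ₀ = 0 := by simp [kleinJ, h4]
    simp only [hj, zero_mul, sub_zero, h4, if_true]
    rw [show ((fun τ : ℍ ↦ E₄ τ ^ 3) ∘ ofComplex) = ((E₄ : ℍ → ℂ) ∘ ofComplex) ^ 3 from rfl,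
      analyticOrderAt_pow h4a, analyticOrderAt_E₄, if_pos h4]
    rfl
  by_cases h6 : E₆ τ₀ = 0
  · -- orbit of i: `j(τ₀) = 1728`, the form is `E₄³ − 1728Δ = E₆²`
    have hj : kleinJ τ₀ = 1728 := kleinJ_eq_1728_iff.mpr (E₆_eq_zero_iff.mp h6)
    simp only [hj, h4, h6, if_false, if_true]
    have : ((fun τ : ℍ ↦ E₄ τ ^ 3 - 1728 * ModularForm.discriminant τ) ∘ ofComplex) =
        ((E₆ : ℍ → ℂ) ∘ ofComplex) ^ 2 := by
      funext z
      simp only [Function.comp_apply, Pi.pow_apply, ModularForm.discriminant_eq_E₄_cube_sub_E₆_sq]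
      ring
    rw [this, analyticOrderAt_pow h6a, analyticOrderAt_E₆, if_pos h6]
    rfl
  · -- generic point: simple zero since `j'(τ₀) ≠ 0`
    simp only [h4, h6, if_false]
    have hform : ((fun τ : ℍ ↦ E₄ τ ^ 3 - kleinJ τ₀ * ModularForm.discriminant τ) ∘ ofComplex) =
        fun z ↦ (ModularForm.discriminant ∘ ofComplex) z * ((kleinJ ∘ ofComplex) z - kleinJ τ₀) := by
      funext z
      simp only [Function.comp_apply]
      rw [E₄_cube_eq_kleinJ_mul]
      ring
    have hja : AnalyticAt ℂ (kleinJ ∘ ofComplex) τ₀ := analyticAt_comp_ofComplex mdifferentiable_kleinJ τ₀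
    have hj1 : analyticOrderAt (fun z ↦ (kleinJ ∘ ofComplex) z - kleinJ τ₀) τ₀ = 1 := by
      have := hja.analyticOrderAt_sub_eq_one_of_deriv_ne_zero
        ((deriv_kleinJ_ne_zero_iff τ₀).mpr ⟨h4, h6⟩)
      simpa [Function.comp_apply, ofComplex_apply] using this
    have hsub : AnalyticAt ℂ (fun z ↦ (kleinJ ∘ ofComplex) z - kleinJ τ₀) τ₀ := hja.sub analyticAt_const
    rw [hform, show (fun z ↦ (ModularForm.discriminant ∘ ofComplex) z * ((kleinJ ∘ ofComplex) z - kleinJ τ₀))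
        = (ModularForm.discriminant ∘ ofComplex) * (fun z ↦ (kleinJ ∘ ofComplex) z - kleinJ τ₀) from rfl,
      analyticOrderAt_mul hΔa hsub, analyticOrderAt_discriminant, hj1, zero_add]

end Literature.NumberTheory.EllipticCurves.ModularForms

end
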